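import Summits.ABC.IUTFork.Repair.RHHullCellSlackLaw
import HarnessLib

/-!
# R-H ROUND 3 (C-ii) SLACK-LAW, §3c «CREDIT»: the exact cell's deficit PER UNIT DEMAND is NON-DECREASING in the label for EVERY pair of
# labels `j ≤ L` — so every partial-credit level certifies an INITIAL SEGMENT of labels, and the required credit is MAXIMAL AT THE TOP label

PROOF-ONLY file (0 definitions, 0 `Prop` facts) of the abc-iut cell (D-0079 RESCUE sub-cell R-H, rung LADDER-ABC:A2.RESCUE.H; ROUND 3
`plan/rescue/R-H/ROUND3/START-HERE.md` v1.1 (C-ii)). CONTENT AUTHORED BY abc-iut-rh3-tst-3 g2 (tester seat; kernel probe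
`HOME/abc-iut-rh3-tst-3/lean/PCreditMono.lean` sha16 2613bc86f9e3f412, STATUS 2026-08-27T01:52:45Z + 01:55:01Z «land as §3c next to
`RHHullCellSlackLaw` §3, not free-standing»); RESTATED in the SLACK-LAW currency and LANDED by abc-iut-rh-typ-3 g7 (row-3 typer / SLACK-LAW kernel
companion). Sits next to the (C-ii) pair: abc-iut-rh2-tab-2's per-cell `RHHullCellSlackLaw` (§1 `demand_sub_price_eq`, `margin_eq_price_sub_demand`;
§2 `deficit_mono_of_not_hullCellδ`; §3 `price_succ_mul_demand_le` = the FLOOR-FREE credit fraction antitone under the successor step) and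
abc-iut-rh-typ-3's summed `RHHullCellSlackSum`; inputs BY NAME: abc-iut-rh2-w-2's `RH.HullCellSlice.hullCellδ_iff_demand_le_price` / `gain_bounds`.

THE CELL: `RH.DiffPricedHull.HullCellδ e m j δ r_in r_out :⟺ e·⌊(j²m − jδ − (j+1)r_in)/e⌋ ≤ m − (j+1)·r_out` (row 4's exact U2 cell of the R-W
WINDOW-TABLE, MIN-SLICE §(i-w2).1). CURRENCY (spelled out in every statement, no `def`): DEMAND `d_j := (j²−1)·m`, log-shell span `G := r_in − r_out`,
residue `ρ_j := (j²m − jδ − (j+1)r_in) mod e ∈ [0, e−1]`, PRICE `price_j := j·δ + (j+1)·G + ρ_j`, exact DEFICIT `def_j := d_j − price_j`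
(= `−margin_U2cell(w,j)`; the cell holds iff `def_j ≤ 0`); FLOOR form of the same number `def_j = e·⌊(j²m − jδ − (j+1)r_in)/e⌋ + (j+1)·r_out − m`.

WHAT IS PROVED (namespace `Summit.ABC.IUTFork.Repair.RH.HullCellSlackCredit`), under the two structural facts of a local field used throughout
`RHHullCellSlice` (`e − 1 ≤ δ`, `r_out ≤ r_in`) and `0 < e` — and, unlike the successor-step lemmas there, WITHOUT `0 ≤ m`:
* §1 `floorDeficit_eq_deficit` (the two deficit currencies agree), `hullCellδ_iff_deficit_nonpos`, `hullCellδ_iff_floorDeficit_nonpos`.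
* §2 **`deficit_cross_identity`** `(j²−1)·def_L − (L²−1)·def_j = δ(L−j)(Lj+1) + G(L+1)(j+1)(L−j) + (L²−1)ρ_j − (j²−1)ρ_L` (`ring`);
  **`deficit_cross_slack`**: for `1 ≤ j < L` that difference is `≥ (e−1)·(j(L−j)+2)` (the residues are paid for by the different: this slack is what
  the floor-free statement `price_succ_mul_demand_le` does not supply); **`deficit_cross_mono`** `(L²−1)·def_j ≤ (j²−1)·def_L` for `1 ≤ j ≤ L` —
  the EXACT, floor-residue deficit per unit demand is non-decreasing in the label, for an ARBITRARY pair of labels; `floorDeficit_cross_mono` (floor form).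
* §3 **`hullCellδ_anti_of_le`**: quantitative downward closure — IN at `L` ⟹ IN at every `1 ≤ j ≤ L`, re-deriving `HullCellSlice.hullCellδ_anti`
  without its hypothesis `0 ≤ m`; `forall_hullCellδ_iff_top` «whole place IN ⟺ top label IN».
* §4 **`credited_anti`**: for EVERY credit level `c = K/N` (`0 < N`, any `K`) the CREDITED cell `N·def_j ≤ K·d_j` (deficit allowed up to the fraction
  `c` of the demand) is downward closed in the label — GEN6-PCREDIT PC-2 «credited cells form an initial segment, 0 sporadic» as a THEOREM of the typed
  cell, not a 7,809-packet count; **`forall_credited_iff_top`** (PC-3): a place is wholly credited at level `c` iff its TOP label is;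
  **`requiredCredit_mono`** (ℚ, `0 < m`, `2 ≤ j ≤ L`): `def_j/d_j ≤ def_L/d_L` — PC-1 (ii) «required credit maximal at the top label».
* §5 sanity rows by `decide`: the tame toy place `e = 3, δ = 2, r_in = r_out = 1, m = 1` (exact segment `{1,2,3}`, credit-½ segment `{1,…,4}`) and
  HEX `λ₈ @ l = 11`, `p = 7` (`e = 165, m = 120, δ = 164, r_in = 28, r_out = −281`, `l⋆ = 5`, top deficit `174` against demand `2880`,
  `RHHullCellSlackLaw.row_hex8_l11`): the whole place is credited at `c = 1/16` and not at `c = 1/17`; `hex8_l11_credited_all_sixteenth` = §4 applied.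
READING for round 3 (no new object): with rh-kit-2 PASS 20's covered fraction `κ_j ≈ ĵ/j`, the per-cell REQUIRED credit `1 − κ_j = def_j/d_j` only grows
with the label (here: exactly, at every local type), so a candidate paying a uniform fraction `c` of each cell's demand licenses the initial segment
`{j : def_j ≤ c·d_j}` and is whole at a place iff `c ≥ def_{l⋆}/d_{l⋆}` — the S1 screen quantity is the TOP-label required credit, place by place.
HONEST FRAMING: integer/rational inequalities about OUR typed cell only; whether any credit can be banked in the volume computation is a question for a
candidate object, not asserted here; nothing here asserts that abc is proved or refuted, or that [IUTchIII] Cor. 3.12 holds or fails at any datum, or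
takes a side on any author; typed ≠ proved; computed ≠ proved. [cite: Mochizuki2012, IUTchIII Cor. 3.12 Step (xi-f) p. 184; IUTchIV Prop. 1.4 p. 13]
[claim: Mochizuki2012, status: disputed] for every IUT locution.
-/

namespace Summit.ABC.IUTFork.Repair.RH.HullCellSlackCredit

open Summit.ABC.IUTFork.Repair.RH.DiffPricedHull
open Summit.ABC.IUTFork.Repair.RH.HullCellSlice
open Summit.ABC.IUTFork.Repair.RH.HullCellSlackLaw

/-! ## §1. The two deficit currencies agree -/

/-- **Floor form = demand − price**: `e·⌊(j²m − jδ − (j+1)r_in)/e⌋ + (j+1)·r_out − m = d_j − price_j` (every `e`; `e·⌊A/e⌋ = A − A mod e`) —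
`RHHullCellSlackLaw.margin_eq_price_sub_demand` with the sign flipped: abc-iut-rh3-tst-3's `deficit` IS the SLACK-LAW deficit. [folklore] -/
theorem floorDeficit_eq_deficit (e m j δ rin rout : ℤ) :
    e * ((j ^ 2 * m - j * δ - (j + 1) * rin) / e) + (j + 1) * rout - m
      = (j ^ 2 - 1) * m - (j * δ + (j + 1) * (rin - rout) + (j ^ 2 * m - j * δ - (j + 1) * rin) % e) := by
  have h := margin_eq_price_sub_demand e m j δ rin rout
  linarith

/-- **The cell holds iff its deficit is non-positive** (`demand − price` form; any `e`). [folklore] -/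
theorem hullCellδ_iff_deficit_nonpos (e m j δ rin rout : ℤ) :
    HullCellδ e m j δ rin rout ↔
      (j ^ 2 - 1) * m - (j * δ + (j + 1) * (rin - rout) + (j ^ 2 * m - j * δ - (j + 1) * rin) % e) ≤ 0 := by
  rw [hullCellδ_iff_demand_le_price]
  constructor <;> intro h <;> linarith

/-- **The cell holds iff its floor-form deficit is non-positive** (literally the definition of `HullCellδ`, rearranged). [folklore] -/
theorem hullCellδ_iff_floorDeficit_nonpos (e m j δ rin rout : ℤ) :
    HullCellδ e m j δ rin rout ↔ e * ((j ^ 2 * m - j * δ - (j + 1) * rin) / e) + (j + 1) * rout - m ≤ 0 := by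
  unfold HullCellδ
  constructor <;> intro h <;> linarith

/-! ## §2. The cross-label identity, its slack, and the main inequality -/

/-- **CROSS-LABEL IDENTITY.** For every pair of labels `j, L` (no hypotheses):
`(j²−1)·def_L − (L²−1)·def_j = δ·(L−j)(Lj+1) + G·(L+1)(j+1)(L−j) + (L²−1)·ρ_j − (j²−1)·ρ_L` with `G = r_in − r_out` — the demand terms
`(j²−1)(L²−1)·m` cancel, which is why NO sign hypothesis on `m` is needed below. (`ring`, residues as atoms.) [folklore] -/
theorem deficit_cross_identity (e m j L δ rin rout : ℤ) :
    (j ^ 2 - 1) * ((L ^ 2 - 1) * m - (L * δ + (L + 1) * (rin - rout) + (L ^ 2 * m - L * δ - (L + 1) * rin) % e))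
        - (L ^ 2 - 1) * ((j ^ 2 - 1) * m - (j * δ + (j + 1) * (rin - rout) + (j ^ 2 * m - j * δ - (j + 1) * rin) % e))
      = δ * ((L - j) * (L * j + 1)) + (rin - rout) * ((L + 1) * (j + 1) * (L - j))
          + (L ^ 2 - 1) * ((j ^ 2 * m - j * δ - (j + 1) * rin) % e)
          - (j ^ 2 - 1) * ((L ^ 2 * m - L * δ - (L + 1) * rin) % e) := by
  ring

/-- **SLACK of the cross-label comparison** (`0 < e`, `e − 1 ≤ δ`, `r_out ≤ r_in`, `1 ≤ j < L`):
`(e − 1)·(j(L−j) + 2) ≤ (j²−1)·def_L − (L²−1)·def_j`. From the identity: `δ(L−j)(Lj+1) ≥ (e−1)(Lj+1)`, the `G`-term is `≥ 0`, `(L²−1)ρ_j ≥ 0`,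
`(j²−1)ρ_L ≤ (j²−1)(e−1)`, and `(Lj+1) − (j²−1) = j(L−j) + 2`. This positive slack is what absorbs the floor residues — the floor-free successor-step
statement `RHHullCellSlackLaw.price_succ_mul_demand_le` does not supply it. [folklore] -/
theorem deficit_cross_slack {e m j L δ rin rout : ℤ} (he : 0 < e) (hδ : e - 1 ≤ δ) (hio : rout ≤ rin)
    (hj : 1 ≤ j) (hjL : j < L) :
    (e - 1) * (j * (L - j) + 2) ≤
      (j ^ 2 - 1) * ((L ^ 2 - 1) * m - (L * δ + (L + 1) * (rin - rout) + (L ^ 2 * m - L * δ - (L + 1) * rin) % e))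
        - (L ^ 2 - 1) * ((j ^ 2 - 1) * m - (j * δ + (j + 1) * (rin - rout) + (j ^ 2 * m - j * δ - (j + 1) * rin) % e)) := by
  rw [deficit_cross_identity]
  obtain ⟨hrj0, _⟩ := gain_bounds he m j δ rin
  obtain ⟨_, hrL1⟩ := gain_bounds he m L δ rin
  have hδ0 : 0 ≤ δ := by linarith
  have hLj : 1 ≤ L - j := by omega
  have hLjpos : 0 ≤ L * j + 1 := by
    have := mul_nonneg (show (0 : ℤ) ≤ L by omega) (show (0 : ℤ) ≤ j by omega)
    linarith
  -- δ(L−j)(Lj+1) ≥ (e−1)(Lj+1)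
  have hα : 0 ≤ δ * (L - j) - (e - 1) := by
    have := mul_nonneg hδ0 (show (0 : ℤ) ≤ L - j - 1 by omega)
    linarith
  have hβ : 0 ≤ (L * j + 1) * (δ * (L - j) - (e - 1)) := mul_nonneg hLjpos hα
  have h1 : (L * j + 1) * (e - 1) ≤ δ * ((L - j) * (L * j + 1)) := by linarith [hβ]
  -- the log-shell term is non-negative
  have h2 : 0 ≤ (rin - rout) * ((L + 1) * (j + 1) * (L - j)) := by
    apply mul_nonneg (by omega)
    exact mul_nonneg (mul_nonneg (by omega) (by omega)) (by omega)
  -- the residues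
  have hL2 : 0 ≤ L ^ 2 - 1 := by nlinarith
  have hj2 : 0 ≤ j ^ 2 - 1 := by nlinarith
  have h3 : 0 ≤ (L ^ 2 - 1) * ((j ^ 2 * m - j * δ - (j + 1) * rin) % e) := mul_nonneg hL2 hrj0
  have h4 : (j ^ 2 - 1) * ((L ^ 2 * m - L * δ - (L + 1) * rin) % e) ≤ (j ^ 2 - 1) * (e - 1) :=
    mul_le_mul_of_nonneg_left hrL1 hj2
  have h5 : (e - 1) * (j * (L - j) + 2) + (j ^ 2 - 1) * (e - 1) = (L * j + 1) * (e - 1) := by ring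
  linarith [h1, h2, h3, h4, h5]

/-- **MAIN INEQUALITY — deficit per unit demand is NON-DECREASING in the label** (`0 < e`, `e − 1 ≤ δ`, `r_out ≤ r_in`, `1 ≤ j ≤ L`; any `m`):
`(L²−1)·def_j ≤ (j²−1)·def_L`, the EXACT (floor-residue) statement for an ARBITRARY pair of labels (abc-iut-rh3-tst-3 g2's `deficit_cross_mono`;
pre-typing scan 142,128 tuples, 0 violations; holes only at `δ < e − 1`). [folklore] -/
theorem deficit_cross_mono {e m j L δ rin rout : ℤ} (he : 0 < e) (hδ : e - 1 ≤ δ) (hio : rout ≤ rin)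
    (hj : 1 ≤ j) (hjL : j ≤ L) :
    (L ^ 2 - 1) * ((j ^ 2 - 1) * m - (j * δ + (j + 1) * (rin - rout) + (j ^ 2 * m - j * δ - (j + 1) * rin) % e))
      ≤ (j ^ 2 - 1) * ((L ^ 2 - 1) * m - (L * δ + (L + 1) * (rin - rout) + (L ^ 2 * m - L * δ - (L + 1) * rin) % e)) := by
  rcases eq_or_lt_of_le hjL with rfl | hlt
  · exact le_refl _
  have hs := deficit_cross_slack (m := m) he hδ hio hj hlt
  have h0 : 0 ≤ (e - 1) * (j * (L - j) + 2) := by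
    apply mul_nonneg (by omega)
    have := mul_nonneg (show (0 : ℤ) ≤ j by omega) (show (0 : ℤ) ≤ L - j by omega)
    linarith
  linarith

/-- **The same in the floor currency**: `(L²−1)·(e⌊A_j/e⌋ + (j+1)r_out − m) ≤ (j²−1)·(e⌊A_L/e⌋ + (L+1)r_out − m)` with
`A_x = x²m − xδ − (x+1)r_in` (`0 < e`, `e − 1 ≤ δ`, `r_out ≤ r_in`, `1 ≤ j ≤ L`) — abc-iut-rh3-tst-3's statement verbatim up to unfolding its
abbreviation. [folklore] -/
theorem floorDeficit_cross_mono {e m j L δ rin rout : ℤ} (he : 0 < e) (hδ : e - 1 ≤ δ) (hio : rout ≤ rin)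
    (hj : 1 ≤ j) (hjL : j ≤ L) :
    (L ^ 2 - 1) * (e * ((j ^ 2 * m - j * δ - (j + 1) * rin) / e) + (j + 1) * rout - m)
      ≤ (j ^ 2 - 1) * (e * ((L ^ 2 * m - L * δ - (L + 1) * rin) / e) + (L + 1) * rout - m) := by
  rw [floorDeficit_eq_deficit, floorDeficit_eq_deficit]
  exact deficit_cross_mono he hδ hio hj hjL

/-! ## §3. Quantitative downward closure of the exact cell -/

/-- **IN at `L` ⟹ IN at every `1 ≤ j ≤ L`** (`0 < e`, `e − 1 ≤ δ`, `r_out ≤ r_in`; ANY `m`): `(L²−1)·def_j ≤ (j²−1)·def_L ≤ 0` and `L² − 1 > 0`.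
Re-derives `HullCellSlice.hullCellδ_anti` and DROPS its hypothesis `0 ≤ m` (the demand cancels in the cross-label identity). [folklore] -/
theorem hullCellδ_anti_of_le {e m j L δ rin rout : ℤ} (he : 0 < e) (hδ : e - 1 ≤ δ) (hio : rout ≤ rin) (hj : 1 ≤ j)
    (hjL : j ≤ L) (h : HullCellδ e m L δ rin rout) : HullCellδ e m j δ rin rout := by
  rcases eq_or_lt_of_le hjL with rfl | hlt
  · exact h
  rw [hullCellδ_iff_deficit_nonpos] at h ⊢
  have hm := deficit_cross_mono (m := m) he hδ hio hj hjL
  have hL : 0 < L ^ 2 - 1 := by nlinarith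
  have hj2 : 0 ≤ j ^ 2 - 1 := by nlinarith
  have h0 := mul_le_mul_of_nonneg_left h hj2
  rw [mul_zero] at h0
  have h1 : (L ^ 2 - 1) * ((j ^ 2 - 1) * m - (j * δ + (j + 1) * (rin - rout) + (j ^ 2 * m - j * δ - (j + 1) * rin) % e))
      ≤ (L ^ 2 - 1) * 0 := by
    rw [mul_zero]; exact le_trans hm h0
  exact le_of_mul_le_mul_left h1 hL

/-- **Whole place IN ⟺ top label IN** (`0 < e`, `e − 1 ≤ δ`, `r_out ≤ r_in`, `1 ≤ L`; any `m`): all labels `1 … L` satisfy the exact cell iff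
the label `L` does (read `L = l⋆`). [folklore] -/
theorem forall_hullCellδ_iff_top {e m L δ rin rout : ℤ} (he : 0 < e) (hδ : e - 1 ≤ δ) (hio : rout ≤ rin) (hL : 1 ≤ L) :
    (∀ j : ℤ, 1 ≤ j → j ≤ L → HullCellδ e m j δ rin rout) ↔ HullCellδ e m L δ rin rout :=
  ⟨fun h => h L hL le_rfl, fun h _ hj hjL => hullCellδ_anti_of_le he hδ hio hj hjL h⟩

/-! ## §4. Partial credit: every level certifies an initial segment; the required credit is maximal at the top label -/

/-- **PC-2 AS A THEOREM — the CREDITED cell is downward closed in the label, for EVERY credit level.** Fix a level `c = K/N` (`0 < N`, any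
integer `K`) and call label `j` CREDITED when `N·def_j ≤ K·d_j` (`d_j = (j²−1)·m`: the deficit may reach the fraction `c` of the demand). If `L` is
credited then so is every `1 ≤ j ≤ L` (`0 < e`, `e − 1 ≤ δ`, `r_out ≤ r_in`; any `m`, any `K`): `(L²−1)·N·def_j ≤ (j²−1)·N·def_L ≤ (j²−1)·K·(L²−1)·m`,
divide by `L² − 1 > 0`. Hence at every place and for EVERY `c` the credited labels form an INITIAL SEGMENT — «0 sporadic cells» is a law of the typed
cell (abc-iut-rh3-gen-6 g2 GEN6-PCREDIT PC-2; abc-iut-rh3-tst-3 g2 `credited_anti`). `K = 0` is §3. [folklore] -/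
theorem credited_anti {e m j L δ rin rout K N : ℤ} (he : 0 < e) (hδ : e - 1 ≤ δ) (hio : rout ≤ rin)
    (hN : 0 < N) (hj : 1 ≤ j) (hjL : j ≤ L)
    (h : N * ((L ^ 2 - 1) * m - (L * δ + (L + 1) * (rin - rout) + (L ^ 2 * m - L * δ - (L + 1) * rin) % e))
      ≤ K * ((L ^ 2 - 1) * m)) :
    N * ((j ^ 2 - 1) * m - (j * δ + (j + 1) * (rin - rout) + (j ^ 2 * m - j * δ - (j + 1) * rin) % e))
      ≤ K * ((j ^ 2 - 1) * m) := by
  rcases eq_or_lt_of_le hjL with rfl | hlt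
  · exact h
  have hmono := deficit_cross_mono (m := m) he hδ hio hj hjL
  -- generalise the two deficits to atoms
  generalize ((j ^ 2 - 1) * m - (j * δ + (j + 1) * (rin - rout) + (j ^ 2 * m - j * δ - (j + 1) * rin) % e)) = Dj at hmono ⊢
  generalize ((L ^ 2 - 1) * m - (L * δ + (L + 1) * (rin - rout) + (L ^ 2 * m - L * δ - (L + 1) * rin) % e)) = DL at hmono h
  have hL : 0 < L ^ 2 - 1 := by nlinarith
  have hj2 : 0 ≤ j ^ 2 - 1 := by nlinarith
  have step1 : (L ^ 2 - 1) * (N * Dj) ≤ (j ^ 2 - 1) * (N * DL) := by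
    have := mul_le_mul_of_nonneg_left hmono (le_of_lt hN)
    linarith
  have step2 : (j ^ 2 - 1) * (N * DL) ≤ (j ^ 2 - 1) * (K * ((L ^ 2 - 1) * m)) := mul_le_mul_of_nonneg_left h hj2
  have step3 : (L ^ 2 - 1) * (N * Dj) ≤ (L ^ 2 - 1) * (K * ((j ^ 2 - 1) * m)) := by
    calc (L ^ 2 - 1) * (N * Dj) ≤ (j ^ 2 - 1) * (K * ((L ^ 2 - 1) * m)) := step1.trans step2
      _ = (L ^ 2 - 1) * (K * ((j ^ 2 - 1) * m)) := by ring
  exact le_of_mul_le_mul_left step3 hL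

/-- **PC-3 AS A THEOREM — a place is WHOLLY credited at level `c = K/N` iff its TOP label is** (`0 < e`, `e − 1 ≤ δ`, `r_out ≤ r_in`, `0 < N`,
`1 ≤ L`; any `m`, any `K`): `(∀ 1 ≤ j ≤ L, N·def_j ≤ K·d_j) ⟺ N·def_L ≤ K·d_L` (read `L = l⋆`). So «datum whole at level `c`» ⟺ `c ≥` the maximum
over its bad places of the TOP-label required credit `def_{l⋆}/d_{l⋆}` — the S1 screen quantity, place by place. [folklore] -/
theorem forall_credited_iff_top {e m L δ rin rout K N : ℤ} (he : 0 < e) (hδ : e - 1 ≤ δ) (hio : rout ≤ rin) (hN : 0 < N)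
    (hL : 1 ≤ L) :
    (∀ j : ℤ, 1 ≤ j → j ≤ L →
        N * ((j ^ 2 - 1) * m - (j * δ + (j + 1) * (rin - rout) + (j ^ 2 * m - j * δ - (j + 1) * rin) % e))
          ≤ K * ((j ^ 2 - 1) * m)) ↔
      N * ((L ^ 2 - 1) * m - (L * δ + (L + 1) * (rin - rout) + (L ^ 2 * m - L * δ - (L + 1) * rin) % e))
        ≤ K * ((L ^ 2 - 1) * m) :=
  ⟨fun h => h L hL le_rfl, fun h _ hj hjL => credited_anti he hδ hio hN hj hjL h⟩

/-- **PC-1 (ii) AS A THEOREM — the REQUIRED CREDIT `def_j / d_j` is non-decreasing in the label** (ℚ; `0 < e`, `e − 1 ≤ δ`, `r_out ≤ r_in`,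
`0 < m`, `2 ≤ j ≤ L` so that both demands are positive): `def_j/((j²−1)m) ≤ def_L/((L²−1)m)`. Its maximum over a place's labels `2 … l⋆` is
therefore attained at the TOP label `l⋆` (abc-iut-rh3-tst-3 g2 `requiredCredit_mono`; with rh-kit-2 PASS 20's covered fraction `κ_j`, `1 − κ_j`
only grows with `j`). [folklore] -/
theorem requiredCredit_mono {e m j L δ rin rout : ℤ} (he : 0 < e) (hδ : e - 1 ≤ δ) (hio : rout ≤ rin) (hm : 0 < m)
    (hj : 2 ≤ j) (hjL : j ≤ L) :
    (((j ^ 2 - 1) * m - (j * δ + (j + 1) * (rin - rout) + (j ^ 2 * m - j * δ - (j + 1) * rin) % e) : ℤ) : ℚ)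
        / (((j : ℚ) ^ 2 - 1) * m) ≤
      (((L ^ 2 - 1) * m - (L * δ + (L + 1) * (rin - rout) + (L ^ 2 * m - L * δ - (L + 1) * rin) % e) : ℤ) : ℚ)
        / (((L : ℚ) ^ 2 - 1) * m) := by
  have hmono := deficit_cross_mono (m := m) he hδ hio (by omega) hjL
  generalize ((j ^ 2 - 1) * m - (j * δ + (j + 1) * (rin - rout) + (j ^ 2 * m - j * δ - (j + 1) * rin) % e)) = Dj at hmono ⊢
  generalize ((L ^ 2 - 1) * m - (L * δ + (L + 1) * (rin - rout) + (L ^ 2 * m - L * δ - (L + 1) * rin) % e)) = DL at hmono ⊢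
  have hj2 : (0 : ℚ) < (j : ℚ) ^ 2 - 1 := by
    have : (2 : ℚ) ≤ j := by exact_mod_cast hj
    nlinarith
  have hL2 : (0 : ℚ) < (L : ℚ) ^ 2 - 1 := by
    have : (2 : ℚ) ≤ L := by exact_mod_cast (le_trans hj hjL)
    nlinarith
  have hmq : (0 : ℚ) < m := by exact_mod_cast hm
  rw [div_le_div_iff₀ (mul_pos hj2 hmq) (mul_pos hL2 hmq)]
  have hq : ((L : ℚ) ^ 2 - 1) * (Dj : ℚ) ≤ ((j : ℚ) ^ 2 - 1) * (DL : ℚ) := by exact_mod_cast hmono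
  have hq' := mul_le_mul_of_nonneg_right hq hmq.le
  linarith [hq']

/-! ## §5. Sanity rows (`decide`) -/

/-- The tame toy place `e = 3, m = 1, δ = 2, r_in = r_out = 1` (abc-iut-rh3-tst-3's row): deficits `def_3 = 0` (IN), `def_4 = 7 > 0` (OFF, so the
exact segment is `{1,2,3}` by §3), and at credit `c = 1/2` (`K = 1, N = 2`): label `4` is credited (`2·7 ≤ 15`) and label `5` is not
(`def_5 = 14`, `2·14 > 24`) — the credit-½ segment is `{1,…,4}`, an initial segment as §4 predicts. [folklore] -/
theorem row_toy_e3 :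
    ((3 : ℤ) ^ 2 - 1) * 1 - (3 * 2 + (3 + 1) * (1 - 1) + ((3 : ℤ) ^ 2 * 1 - 3 * 2 - (3 + 1) * 1) % 3) = 0 ∧
    ((4 : ℤ) ^ 2 - 1) * 1 - (4 * 2 + (4 + 1) * (1 - 1) + ((4 : ℤ) ^ 2 * 1 - 4 * 2 - (4 + 1) * 1) % 3) = 7 ∧
    ((5 : ℤ) ^ 2 - 1) * 1 - (5 * 2 + (5 + 1) * (1 - 1) + ((5 : ℤ) ^ 2 * 1 - 5 * 2 - (5 + 1) * 1) % 3) = 14 ∧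
    (2 : ℤ) * 7 ≤ 1 * (((4 : ℤ) ^ 2 - 1) * 1) ∧ ¬ (2 : ℤ) * 14 ≤ 1 * (((5 : ℤ) ^ 2 - 1) * 1) := by
  decide

/-- HEX `λ₈ @ l = 11`, `p = 7` (`e = 165, m = 120, δ = 164, r_in = 28, r_out = −281`, `l⋆ = 5`): the top-label deficit is `174` against the demand
`d_5 = 2880` (`RHHullCellSlackLaw.row_hex8_l11`), so the TOP-label required credit is `174/2880 = 29/480 ≈ 0.060`: the top label is credited at
`c = 1/16` (`16·174 = 2784 ≤ 2880`) and not at `c = 1/17` (`17·174 = 2958 > 2880`). [folklore] -/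
theorem row_hex8_l11_top_credit :
    (16 : ℤ) * (((5 : ℤ) ^ 2 - 1) * 120
        - (5 * 164 + (5 + 1) * (28 - (-281)) + ((5 : ℤ) ^ 2 * 120 - 5 * 164 - (5 + 1) * 28) % 165)) ≤ 1 * (((5 : ℤ) ^ 2 - 1) * 120) ∧
    ¬ (17 : ℤ) * (((5 : ℤ) ^ 2 - 1) * 120
        - (5 * 164 + (5 + 1) * (28 - (-281)) + ((5 : ℤ) ^ 2 * 120 - 5 * 164 - (5 + 1) * 28) % 165)) ≤ 1 * (((5 : ℤ) ^ 2 - 1) * 120) := by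
  decide

/-- **§4 applied to the HEX `λ₈ @ l = 11` place**: at credit level `c = 1/16` EVERY label `1 ≤ j ≤ 5 = l⋆` is credited — by `forall_credited_iff_top`
from the single top-label check of `row_hex8_l11_top_credit` (structural facts: `e − 1 = 164 ≤ δ = 164`, `r_out = −281 ≤ 28 = r_in`). [folklore] -/
theorem hex8_l11_credited_all_sixteenth (j : ℤ) (hj : 1 ≤ j) (hj5 : j ≤ 5) :
    (16 : ℤ) * ((j ^ 2 - 1) * 120 - (j * 164 + (j + 1) * (28 - (-281)) + (j ^ 2 * 120 - j * 164 - (j + 1) * 28) % 165))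
      ≤ 1 * ((j ^ 2 - 1) * 120) :=
  (forall_credited_iff_top (e := 165) (m := 120) (δ := 164) (rin := 28) (rout := -281) (K := 1) (N := 16)
      (by norm_num) (by norm_num) (by norm_num) (by norm_num) (by norm_num)).mpr
    row_hex8_l11_top_credit.1 j hj hj5

end Summit.ABC.IUTFork.Repair.RH.HullCellSlackCredit
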